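import Literature.MathematicalPhysics.QuantumFieldTheory.Balaban1983to89.Node00.Record11
import Literature.MathematicalPhysics.QuantumFieldTheory.Balaban1983to89.Node00.Record10CarriersB8

/-!
# NODE 00 (YM-PLAN Track A) — THE CUMULATIVE CARRIER PINS RESTATED AT def-T's STAGE 11 (`Record11`, the §2 [III] form pinned): the five pins lifted to `Stage11Params`,
# the four-pin and five-pin Stage-11 views, and `IsRecordOfRecord₁₁CB10YZW → IsRecordOfRecord₁₁C` (SAME datum, SAME world; [B10] ∕ [B9] ∕ [B11] ∕ [IV] groups pinned)
# with the faces N06 ∕ N07 ∕ N08 ∕ N12 read at ₁₁ BY NAME; the [B8]-pinned record `IsRecordOfRecord₁₁CB10YZWB8` is the sequel `Node00/Record11CarriersB8`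

NODE 00 RECORD MODULE (seat `pub-ymgap-node00-def` g31, 2026-08-26; trigger t1 of the g30 START list: def-T g3's `Node00/Record11.lean` (DEDUP №11 = 11a–11d; INTENT-11d INBOX l.11826)
ACCEPTED), the ONE-module restate of `Record10Carriers` + `CarriersW` §3 at ₁₁ (def-T WORD-2 l.11717: `Stage11Params` EXTENDS `Stage9Params`, so every pin lifts as
`{ θ with toStage9Params := θ.toStage9Params.pin<G> … }`).  APPEND-ONLY: a NEW importing module; `Record11`, `Record10CarriersB8` (hence `CarriersB8∕W∕Z∕Y∕B10`, `Record10Carriers`)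
untouched and CONSUMED BY NAME.  [Balaban1988Convergent] = T. Bałaban, Commun. Math. Phys. **119** (1988) 243–285 ([III]); [Balaban1989LargeFieldII] = Commun. Math. Phys. **122**
(1989) 355–392.

WHAT IS DEFINED ∕ PROVED (kernel bookkeeping, 0 sorry).  §1 `Stage11Params.pinB10 ∕ pinY ∕ pinZ ∕ pinW ∕ pinB8` (lifted through `toStage9Params`; the §2 data `s2 ∕ Rz ∕ Wt ∕ Ubg`
verbatim), `…_admissible_iff` (`Iff.rfl` ×5), `toStage5₁₁_pin<G>` (`rfl` ×5 — the two `X`-pins through ONE generic re-binding `Stage11Params.rebindX` ∕ `Stage5Params.rebindX` ∕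
`toStage5₁₁_rebindX`, KERNEL LESSON 7: a pinned-vs-unpinned `rfl` whose difference sits in `res.X` behind `withRuns10 (runsB10OfRecord …)` exhausts the default heartbeats at ₁₁
(the failing unification unfolds the run family before giving up, once per nested occurrence); stated at a GENERIC `X'` the same check fails at once and the `rfl` is cheap),
`Provisos₁₁.pin<G>` (field by field: `base` transported by the Stage-10 lemmas, `rzLaws ∕ wtLaws ∕ alphaPos ∕ bg` verbatim), `datumOfRecord₁₁_pin<G>` (`rfl` ×5, the `X`-pins via
`datumOfRecord₁₁_rebindX`), `WOfRecord₁₁ θ := WOfRecord₁₀ θ.toStage9Params` (+ `_pinW ∕ _pinB8 : rfl`), the four-pin view `view₁₁B10YZW` (+ `_eq` composed from single-pin `rfl`s,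
never the multi-pin `rfl`) and its leaves, the five-pin view `view₁₁B8B10YZW` ([B8] innermost) and its leaves (S-binding `b8` = `B8LeafOfRecord`, `Iff.rfl`; C-binding `b8` = `B8LeafR`,
`Iff.rfl`).  §2 **`IsRecordOfRecord₁₁CB10YZW D w`** := `IsRecordOfRecord₁₁C` VERBATIM with the upstream block at the four-pin view; `exists_world_…` (inhabitation = ₁₁C's);
**`isRecordOfRecord₁₁C_of_isRecordOfRecord₁₁CB10YZW`** (SAME D, SAME w: witness the quadruply pinned θ, provisos with EXPLICIT proofs, admissibility by the `iff`s — KERNEL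
LESSON 8: passing `hθ` through four structure updates by defeq also exhausts the heartbeats; the `iff` chain does not), `atWorld_of_…`, `…_rebind_of_isRecordOfRecord₁₁C`,
`leaves_iff_of_…` (rBasicStep ∕ b9 ∕ b10 ∕ b11), `b10_main_iff_of_…` (N08 exactly), `b11_main_iff_bundles_of_…` (N07 at the bundles), `b9_b11_b15_main_of_…_of_slots` (N06 ∕ N07 ∕ N12
slots form).  Residual layers (`OpsY`, `ResidZ`, `ResidW`) EXPLICIT, quantified with the record's parameters, no law assumed — the ∀-forms of N06 ∕ N07 ∕ N12 stay junk-able as at ₁₀.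

HONEST FRAMING: definitions + kernel bookkeeping; NO estimate; nothing of Bałaban's asserted; no node discharged; counts unmoved; one finite T⁴ programme at fixed ε — NOT continuum ∕
ℝ⁴ ∕ infinite volume ∕ OS ∕ mass gap ∕ Clay.  No `sorry`, no `axiom`, no `opaque`, no `instance`, no `notation`. -/

noncomputable section

namespace Literature.MathematicalPhysics.QuantumFieldTheory.Balaban1983to89.Node00

open T4Continuum AveragingRT T4FiniteEpsInhabited FlowStep FlowStepRuns DagBinding T4DatumAssembly
open B8LeafKnitRS (B8LeafRS)
open scoped Matrix.Norms.L2Operator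

/-! ## §1. The five pins lift to Stage-11 parameters and pass through the Stage-11 view, provisos and datum -/

section Pins

variable (F : T4Family) (N : ℕ) [NeZero N]

/-- The [B10] pin of Stage-11 parameters (lifted through `toStage9Params`; the §2-form data untouched). [cite: Balaban1985UV3, (1)–(5) p.256 (bookkeeping)] -/
def Stage11Params.pinB10 (θ : Stage11Params F N) : Stage11Params F N := { θ with toStage9Params := θ.toStage9Params.pinB10 F N }

/-- The Y pin of Stage-11 parameters. [cite: Balaban1985BackgroundPropagators, Thm 3.1 p.397 (bookkeeping)] -/
def Stage11Params.pinY (θ : Stage11Params F N) (Y₀ : PrintedCarriers9X) : Stage11Params F N := { θ with toStage9Params := θ.toStage9Params.pinY F N Y₀ }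

/-- The Z pin of Stage-11 parameters. [cite: Balaban1985Variational, Thm 1 p.279 (bookkeeping)] -/
def Stage11Params.pinZ (θ : Stage11Params F N) (Z₀ : PrintedCarriers11) : Stage11Params F N := { θ with toStage9Params := θ.toStage9Params.pinZ F N Z₀ }

/-- The W pin of Stage-11 parameters. [cite: Balaban1989LargeFieldI, (0.2) p.176 (bookkeeping)] -/
def Stage11Params.pinW (θ : Stage11Params F N) (W₀ : B12.RunParams → PrintedCarriers15) : Stage11Params F N :=
  { θ with toStage9Params := θ.toStage9Params.pinW F N W₀ }

/-- The [B8] pin of Stage-11 parameters. [cite: Balaban1985RegularSpaces, Thm 2 p.83 (bookkeeping)] -/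
def Stage11Params.pinB8 (θ : Stage11Params F N) (lam : ResidB8 θ.toStage3Params) : Stage11Params F N :=
  { θ with toStage9Params := θ.toStage9Params.pinB8 F N lam }

/-- Admissibility is unchanged by the [B10] pin (`Iff.rfl`). [cite: Balaban1987RG1, (1.20)–(1.21) p.264 (hypothesis dictionary; bookkeeping)] -/
theorem Stage11Params.pinB10_admissible_iff (θ : Stage11Params F N) : (θ.pinB10 F N).Admissible ↔ θ.Admissible := Iff.rfl

/-- … by the Y pin … [cite: Balaban1987RG1, (1.20)–(1.21) p.264 (bookkeeping)] -/
theorem Stage11Params.pinY_admissible_iff (θ : Stage11Params F N) (Y₀ : PrintedCarriers9X) : (θ.pinY F N Y₀).Admissible ↔ θ.Admissible := Iff.rfl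

/-- … by the Z pin … [cite: Balaban1987RG1, (1.20)–(1.21) p.264 (bookkeeping)] -/
theorem Stage11Params.pinZ_admissible_iff (θ : Stage11Params F N) (Z₀ : PrintedCarriers11) : (θ.pinZ F N Z₀).Admissible ↔ θ.Admissible := Iff.rfl

/-- … by the W pin … [cite: Balaban1987RG1, (1.20)–(1.21) p.264 (bookkeeping)] -/
theorem Stage11Params.pinW_admissible_iff (θ : Stage11Params F N) (W₀ : B12.RunParams → PrintedCarriers15) : (θ.pinW F N W₀).Admissible ↔ θ.Admissible :=
  Iff.rfl

/-- … and by the [B8] pin. [cite: Balaban1987RG1, (1.20)–(1.21) p.264 (bookkeeping)] -/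
theorem Stage11Params.pinB8_admissible_iff (θ : Stage11Params F N) (lam : ResidB8 θ.toStage3Params) : (θ.pinB8 F N lam).Admissible ↔ θ.Admissible := Iff.rfl

/-- Plumbing: Stage-11 parameters with the run-indexed carrier bundle `X` RE-BOUND to `X'` (every other field verbatim) — the common shape of the [B10] and [B8] pins,
through which the datum lemmas below are stated once (a generic `X'` makes the kernel's «pinned ≠ unpinned» check immediate). [folklore] -/
def Stage11Params.rebindX (θ : Stage11Params F N) (X' : B12.RunParams → PrintedCarriersR) : Stage11Params F N :=
  { θ with toStage9Params := { θ.toStage9Params with res := { θ.res with X := X' } } }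

/-- Plumbing: the same re-binding on Stage-5 parameters. [folklore] -/
def Stage5Params.rebindX (θ : Stage5Params F N) (X' : B12.RunParams → PrintedCarriersR) : Stage5Params F N :=
  { θ with res := { θ.res with X := X' } }

/-- The Stage-11 view commutes with re-binding `X` (`rfl`, once, at a generic re-binding: `residualOfStage11` keeps `X`). [cite: Balaban1988Convergent, p.244 (bookkeeping)] -/
theorem Stage11Params.toStage5₁₁_rebindX (θ : Stage11Params F N) (X' : B12.RunParams → PrintedCarriersR) :
    (θ.rebindX F N X').toStage5₁₁ F N = (θ.toStage5₁₁ F N).rebindX F N X' := rfl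

/-- The Stage-11 view of [B10]-pinned parameters IS the [B10]-pinned Stage-11 view (`rfl`: `residualOfStage11` keeps `X`). [cite: Balaban1985UV3, (1)–(5) p.256 (bookkeeping)] -/
theorem Stage11Params.toStage5₁₁_pinB10 (θ : Stage11Params F N) : (θ.pinB10 F N).toStage5₁₁ F N = (θ.toStage5₁₁ F N).pinB10 F N :=
  Stage11Params.toStage5₁₁_rebindX F N θ _

/-- … Y (`rfl`) … [cite: Balaban1985BackgroundPropagators, Thm 3.1 p.397 (bookkeeping)] -/
theorem Stage11Params.toStage5₁₁_pinY (θ : Stage11Params F N) (Y₀ : PrintedCarriers9X) : (θ.pinY F N Y₀).toStage5₁₁ F N = (θ.toStage5₁₁ F N).pinY F N Y₀ := rfl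

/-- … Z (`rfl`) … [cite: Balaban1985Variational, Thm 1 p.279 (bookkeeping)] -/
theorem Stage11Params.toStage5₁₁_pinZ (θ : Stage11Params F N) (Z₀ : PrintedCarriers11) : (θ.pinZ F N Z₀).toStage5₁₁ F N = (θ.toStage5₁₁ F N).pinZ F N Z₀ := rfl

/-- … W (`rfl`) … [cite: Balaban1989LargeFieldI, (0.2) p.176 (bookkeeping)] -/
theorem Stage11Params.toStage5₁₁_pinW (θ : Stage11Params F N) (W₀ : B12.RunParams → PrintedCarriers15) :
    (θ.pinW F N W₀).toStage5₁₁ F N = (θ.toStage5₁₁ F N).pinW F N W₀ := rfl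

/-- … and [B8] (`rfl`). [cite: Balaban1985RegularSpaces, Thm 2 p.83 (bookkeeping)] -/
theorem Stage11Params.toStage5₁₁_pinB8 (θ : Stage11Params F N) (lam : ResidB8 θ.toStage3Params) :
    (θ.pinB8 F N lam).toStage5₁₁ F N = (θ.toStage5₁₁ F N).pinB8 F N lam :=
  Stage11Params.toStage5₁₁_rebindX F N θ _

/-- The [IV] bundle of record at ₁₁ is ₁₀'s at `toStage9Params` (β, histories and the tower of record are `Record10`'s); it does not read the pinned fields (`rfl` ×2 below).
[cite: Balaban1989LargeFieldI, (0.2)–(0.6) p.176 (bookkeeping)] -/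
def WOfRecord₁₁ (θ : Stage11Params F N) (lam : ResidW F N) (P : B12.RunParams) : PrintedCarriers15 := WOfRecord₁₀ F N θ.toStage9Params lam P

/-- `WOfRecord₁₁ (θ.pinW W₀) = WOfRecord₁₁ θ` (`rfl`). [cite: Balaban1989LargeFieldI, (0.2) p.176 (bookkeeping)] -/
theorem WOfRecord₁₁_pinW (θ : Stage11Params F N) (W₀ : B12.RunParams → PrintedCarriers15) (lam : ResidW F N) :
    WOfRecord₁₁ F N (θ.pinW F N W₀) lam = WOfRecord₁₁ F N θ lam := rfl

/-- `WOfRecord₁₁ (θ.pinB8 lam8) = WOfRecord₁₁ θ` (`rfl`). [cite: Balaban1989LargeFieldI, (0.2) p.176 (bookkeeping)] -/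
theorem WOfRecord₁₁_pinB8 (θ : Stage11Params F N) (lam8 : ResidB8 θ.toStage3Params) (lam : ResidW F N) :
    WOfRecord₁₁ F N (θ.pinB8 F N lam8) lam = WOfRecord₁₁ F N θ lam := rfl

variable {F N}

/-- The Stage-11 provisos read no carrier: they transport along the [B10] pin … [cite: Balaban1988Convergent, (3.2)–(3.9) pp.265–266, (2.23)–(2.42) pp.259–262 (bookkeeping)] -/
theorem Stage11Params.Provisos₁₁.pinB10 {θ : Stage11Params F N} (h : θ.Provisos₁₁) : (θ.pinB10 F N).Provisos₁₁ :=
  ⟨h.base.pinB10, h.rzLaws, h.wtLaws, h.alphaPos, h.bg⟩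

/-- … along the Y pin … [cite: Balaban1988Convergent, (3.2)–(3.9) pp.265–266 (bookkeeping)] -/
theorem Stage11Params.Provisos₁₁.pinY {θ : Stage11Params F N} (h : θ.Provisos₁₁) (Y₀ : PrintedCarriers9X) : (θ.pinY F N Y₀).Provisos₁₁ :=
  ⟨h.base.pinY Y₀, h.rzLaws, h.wtLaws, h.alphaPos, h.bg⟩

/-- … along the Z pin … [cite: Balaban1988Convergent, (3.2)–(3.9) pp.265–266 (bookkeeping)] -/
theorem Stage11Params.Provisos₁₁.pinZ {θ : Stage11Params F N} (h : θ.Provisos₁₁) (Z₀ : PrintedCarriers11) : (θ.pinZ F N Z₀).Provisos₁₁ :=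
  ⟨h.base.pinZ Z₀, h.rzLaws, h.wtLaws, h.alphaPos, h.bg⟩

/-- … along the W pin … [cite: Balaban1988Convergent, (3.2)–(3.9) pp.265–266 (bookkeeping)] -/
theorem Stage11Params.Provisos₁₁.pinW {θ : Stage11Params F N} (h : θ.Provisos₁₁) (W₀ : B12.RunParams → PrintedCarriers15) : (θ.pinW F N W₀).Provisos₁₁ :=
  ⟨h.base.pinW W₀, h.rzLaws, h.wtLaws, h.alphaPos, h.bg⟩

/-- … and along the [B8] pin. [cite: Balaban1988Convergent, (3.2)–(3.9) pp.265–266 (bookkeeping)] -/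
theorem Stage11Params.Provisos₁₁.pinB8 {θ : Stage11Params F N} (h : θ.Provisos₁₁) (lam : ResidB8 θ.toStage3Params) : (θ.pinB8 F N lam).Provisos₁₁ :=
  ⟨h.base.pinB8 lam, h.rzLaws, h.wtLaws, h.alphaPos, h.bg⟩

variable (F N)

/-- THE DATUM DOES NOT READ THE CARRIER BUNDLE `X` (`rfl`, once, at a generic re-binding). [cite: Balaban1989LargeFieldII, Thm 1 + (0.1) pp.355–356 (bookkeeping)] -/
theorem datumOfRecord₁₁_rebindX (θ : Stage11Params F N) (h : θ.Provisos₁₁) (X' : B12.RunParams → PrintedCarriersR) (h' : (θ.rebindX F N X').Provisos₁₁) :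
    datumOfRecord₁₁ F N (θ.rebindX F N X') h' = datumOfRecord₁₁ F N θ h := rfl

/-- THE PINS ARE UP-SIDE at Stage 11: the datum of record is unchanged by the [B10] pin (`rfl`) … [cite: Balaban1989LargeFieldII, Thm 1 + (0.1) pp.355–356 (bookkeeping)] -/
theorem datumOfRecord₁₁_pinB10 (θ : Stage11Params F N) (h : θ.Provisos₁₁) : datumOfRecord₁₁ F N (θ.pinB10 F N) h.pinB10 = datumOfRecord₁₁ F N θ h :=
  datumOfRecord₁₁_rebindX F N θ h _ h.pinB10

/-- … Y (`rfl`) … [cite: Balaban1989LargeFieldII, Thm 1 + (0.1) pp.355–356 (bookkeeping)] -/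
theorem datumOfRecord₁₁_pinY (θ : Stage11Params F N) (h : θ.Provisos₁₁) (Y₀ : PrintedCarriers9X) :
    datumOfRecord₁₁ F N (θ.pinY F N Y₀) (h.pinY Y₀) = datumOfRecord₁₁ F N θ h := rfl

/-- … Z (`rfl`) … [cite: Balaban1989LargeFieldII, Thm 1 + (0.1) pp.355–356 (bookkeeping)] -/
theorem datumOfRecord₁₁_pinZ (θ : Stage11Params F N) (h : θ.Provisos₁₁) (Z₀ : PrintedCarriers11) :
    datumOfRecord₁₁ F N (θ.pinZ F N Z₀) (h.pinZ Z₀) = datumOfRecord₁₁ F N θ h := rfl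

/-- … W (`rfl`) … [cite: Balaban1989LargeFieldII, Thm 1 + (0.1) pp.355–356 (bookkeeping)] -/
theorem datumOfRecord₁₁_pinW (θ : Stage11Params F N) (h : θ.Provisos₁₁) (W₀ : B12.RunParams → PrintedCarriers15) :
    datumOfRecord₁₁ F N (θ.pinW F N W₀) (h.pinW W₀) = datumOfRecord₁₁ F N θ h := rfl

/-- … and [B8] (`rfl`). [cite: Balaban1989LargeFieldII, Thm 1 + (0.1) pp.355–356 (bookkeeping)] -/
theorem datumOfRecord₁₁_pinB8 (θ : Stage11Params F N) (h : θ.Provisos₁₁) (lam : ResidB8 θ.toStage3Params) :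
    datumOfRecord₁₁ F N (θ.pinB8 F N lam) (h.pinB8 lam) = datumOfRecord₁₁ F N θ h :=
  datumOfRecord₁₁_rebindX F N θ h _ (h.pinB8 lam)

/-- **The cumulative four-pin Stage-11 view**: `θ.toStage5₁₁` pinned by `pinB10`, then `pinY (Y9OfRecord …)`, then `pinZ (Z11OfRecord F N ζ)`, then `pinW (WOfRecord₁₁ θ lamW)`.
[cite: Balaban1985UV3, Thm 1 p.257; Balaban1985BackgroundPropagators, Thm 3.1 p.397; Balaban1985Variational, Thm 1 p.279; Balaban1989LargeFieldI, (0.2) p.176 (objects of record)] -/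
def Stage11Params.view₁₁B10YZW (θ : Stage11Params F N) (Mstar : ℕ) (ops : OpsY N θ.toStage3Params Mstar) (ζ : ResidZ F N) (lamW : ResidW F N) :
    Stage5Params F N :=
  ((((θ.toStage5₁₁ F N).pinB10 F N).pinY F N (Y9OfRecord N θ.toStage3Params Mstar ops)).pinZ F N (Z11OfRecord F N ζ)).pinW F N (WOfRecord₁₁ F N θ lamW)

/-- The four-pin view IS the Stage-11 view of the QUADRUPLY PINNED parameters (composed from the single-pin `rfl`s). [cite: Balaban1989LargeFieldII, Thm 1 p.355 (bookkeeping)] -/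
theorem Stage11Params.view₁₁B10YZW_eq (θ : Stage11Params F N) (Mstar : ℕ) (ops : OpsY N θ.toStage3Params Mstar) (ζ : ResidZ F N) (lamW : ResidW F N) :
    θ.view₁₁B10YZW F N Mstar ops ζ lamW =
      ((((θ.pinB10 F N).pinY F N (Y9OfRecord N θ.toStage3Params Mstar ops)).pinZ F N (Z11OfRecord F N ζ)).pinW F N (WOfRecord₁₁ F N θ lamW)).toStage5₁₁ F N := by
  rw [Stage11Params.toStage5₁₁_pinW, Stage11Params.toStage5₁₁_pinZ, Stage11Params.toStage5₁₁_pinY, Stage11Params.toStage5₁₁_pinB10]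
  rfl

/-- The leaves of the C-binding over the four-pin view, by name. [cite: Balaban1989LargeFieldI, Prop. 1 p.194; Balaban1985Variational, Thm 1 p.279; Balaban1985BackgroundPropagators, Thm 3.1 p.397; Balaban1985UV3, Thm 1 p.257 + Thm 2 p.272] -/
theorem upOfRecord₅C_view₁₁B10YZW_leaves (θ : Stage11Params F N) (Mstar : ℕ) (ops : OpsY N θ.toStage3Params Mstar) (ζ : ResidZ F N) (lamW : ResidW F N) (P : B12.RunParams) :
    ((upOfRecord₅C F N (θ.view₁₁B10YZW F N Mstar ops ζ lamW) P).rBasicStep ↔ B15Leaf (WOfRecord₁₁ F N θ lamW P)) ∧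
    ((upOfRecord₅C F N (θ.view₁₁B10YZW F N Mstar ops ζ lamW) P).b9 ↔ B9LeafX (Y9OfRecord N θ.toStage3Params Mstar ops)) ∧
    ((upOfRecord₅C F N (θ.view₁₁B10YZW F N Mstar ops ζ lamW) P).b10 ↔ PrintedUV3V N θ.L) ∧
    ((upOfRecord₅C F N (θ.view₁₁B10YZW F N Mstar ops ζ lamW) P).b11 ↔ B11Leaf (Z11OfRecord F N ζ)) := by
  have hw := upOfRecord₅C_pinW_b9_b10_b11 F N ((((θ.toStage5₁₁ F N).pinB10 F N).pinY F N (Y9OfRecord N θ.toStage3Params Mstar ops)).pinZ F N (Z11OfRecord F N ζ))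
    (WOfRecord₁₁ F N θ lamW) P
  refine ⟨upOfRecord₅C_pinW_rBasicStep_iff F N _ _ P, ?_, ?_, ?_⟩
  · unfold Stage11Params.view₁₁B10YZW
    rw [hw.1, upOfRecord₅C_pinZ_b9]
    exact upOfRecord₅C_pinY_b9_iff F N _ _ P
  · unfold Stage11Params.view₁₁B10YZW
    rw [hw.2.1, upOfRecord₅C_pinZ_b10, upOfRecord₅C_pinY_b10]
    exact upOfRecord₅C_pinB10_b10_iff F N (θ.toStage5₁₁ F N) P
  · unfold Stage11Params.view₁₁B10YZW
    rw [hw.2.2]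
    exact upOfRecord₅C_pinZ_b11_iff F N _ _ P

/-- **The five-pin Stage-11 view with [B8]** ([B8] innermost). [cite: Balaban1985RegularSpaces, Thm 2 p.83 (objects of record)] -/
def Stage11Params.view₁₁B8B10YZW (θ : Stage11Params F N) (lam : ResidB8 θ.toStage3Params) (Mstar : ℕ) (ops : OpsY N θ.toStage3Params Mstar) (ζ : ResidZ F N)
    (lamW : ResidW F N) : Stage5Params F N :=
  (θ.pinB8 F N lam).view₁₁B10YZW F N Mstar ops ζ lamW

/-- The leaves of the S-binding over the five-pin view, by name (`b8` is `Iff.rfl`; the other four are the four-pin faces at `θ.pinB8 lam`).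
[cite: Balaban1985RegularSpaces, Lemma 1 – Thm 8 pp.79–101; Balaban1989LargeFieldI, Prop. 1 p.194; Balaban1985BackgroundPropagators, Thm 3.1 p.397; Balaban1985UV3, Thm 1 p.257; Balaban1985Variational, Thm 1 p.279] -/
theorem upOfRecord₅CS_view₁₁B8B10YZW_leaves (θ : Stage11Params F N) (lam : ResidB8 θ.toStage3Params) (Mstar : ℕ) (ops : OpsY N θ.toStage3Params Mstar)
    (ζ : ResidZ F N) (lamW : ResidW F N) (P : B12.RunParams) :
    ((upOfRecord₅CS F N (θ.view₁₁B8B10YZW F N lam Mstar ops ζ lamW) P).b8 ↔ B8LeafOfRecord θ.toStage3Params lam) ∧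
    ((upOfRecord₅CS F N (θ.view₁₁B8B10YZW F N lam Mstar ops ζ lamW) P).rBasicStep ↔ B15Leaf (WOfRecord₁₁ F N θ lamW P)) ∧
    ((upOfRecord₅CS F N (θ.view₁₁B8B10YZW F N lam Mstar ops ζ lamW) P).b9 ↔ B9LeafX (Y9OfRecord N θ.toStage3Params Mstar ops)) ∧
    ((upOfRecord₅CS F N (θ.view₁₁B8B10YZW F N lam Mstar ops ζ lamW) P).b10 ↔ PrintedUV3V N θ.L) ∧
    ((upOfRecord₅CS F N (θ.view₁₁B8B10YZW F N lam Mstar ops ζ lamW) P).b11 ↔ B11Leaf (Z11OfRecord F N ζ)) :=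
  ⟨Iff.rfl, upOfRecord₅C_view₁₁B10YZW_leaves F N (θ.pinB8 F N lam) Mstar ops ζ lamW P⟩

/-- … and the C-binding's `b8` over the five-pin view is the leaf AS TYPED at the group of record (`Iff.rfl`). [cite: Balaban1985RegularSpaces, Lemma 1 – Thm 8 pp.79–101 (bookkeeping)] -/
theorem upOfRecord₅C_view₁₁B8B10YZW_b8_iff (θ : Stage11Params F N) (lam : ResidB8 θ.toStage3Params) (Mstar : ℕ) (ops : OpsY N θ.toStage3Params Mstar)
    (ζ : ResidZ F N) (lamW : ResidW F N) (P : B12.RunParams) :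
    (upOfRecord₅C F N (θ.view₁₁B8B10YZW F N lam Mstar ops ζ lamW) P).b8 ↔
      B8LeafR θ.D (θ.L : ℝ) lam.C₂ lam.B₁' lam.inp.B₀' lam.B₁ lam.B₂ lam.c₁ lam.inp lam.B₀β (B8Lemma1NonAbelian.blockPairNA θ.D θ.L θ.𝔸)
        (famB8OfRecord θ.toStage3Params lam.β lam.len) lam.lan lam.cub lam.toAxial :=
  Iff.rfl

end Pins

/-! ## §2. `IsRecordOfRecord₁₁CB10YZW` — the four same-world pins at Stage 11 -/

section Record11

variable (F : T4Family) (N : ℕ) [NeZero N]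

/-- **«(D, w) is the record, Stage 11, [B10] ∕ [B9] ∕ [B11] ∕ [IV] groups pinned»**: def-T's `IsRecordOfRecord₁₁C` VERBATIM except that the upstream block is the C-binding at
the four-pin view, for SOME floor, operator layer, [B11] layer and [IV] layer (residual data quantified with the record's parameters; no law assumed).
[cite: Balaban1985UV3, Thm 1 p.257 + Thm 2 p.272; Balaban1985BackgroundPropagators, Thms 3.1–3.15 pp.397–432; Balaban1985Variational, Thm 1 p.279; Balaban1989LargeFieldI, (0.2)–(0.6) p.176; Balaban1988Convergent, (2.18)–(2.42) pp.257–262; Balaban1989LargeFieldII, Thm 1 + (0.1) pp.355–356 (objects of record)] -/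
def IsRecordOfRecord₁₁CB10YZW (D : FiniteEpsData F (SU N)) (w : WorldP) : Prop :=
  ∃ (θ : Stage11Params F N) (h : θ.Provisos₁₁) (Mstar : ℕ) (ops : OpsY N θ.toStage3Params Mstar) (ζ : ResidZ F N) (lamW : ResidW F N),
    θ.Admissible ∧ D = datumOfRecord₁₁ F N θ h ∧ w.C = D.C ∧ (0 < w.γ ∧ w.γ ≤ θ.γ) ∧ w.L = (θ.L : ℝ) ∧
      ∀ P : B12.RunParams, w.up P = upOfRecord₅C F N (θ.view₁₁B10YZW F N Mstar ops ζ lamW) P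

/-- **Inhabitation is Stage 11's EXACTLY** (any four residual layers). [cite: Balaban1989LargeFieldII, Thm 1 + (0.1) pp.355–356 (bookkeeping)] -/
theorem exists_world_isRecordOfRecord₁₁CB10YZW (θ : Stage11Params F N) (h : θ.Provisos₁₁) (hθ : θ.Admissible) (Mstar : ℕ) (ops : OpsY N θ.toStage3Params Mstar)
    (ζ : ResidZ F N) (lamW : ResidW F N) {γw : ℝ} (hγw : 0 < γw ∧ γw ≤ θ.γ) :
    ∃ w : WorldP, IsRecordOfRecord₁₁CB10YZW F N (datumOfRecord₁₁ F N θ h) w ∧ w.γ = γw := by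
  obtain ⟨w₀, -, -⟩ := exists_world_isRecordOfRecord₁₁C F N θ h hθ hγw
  exact ⟨{ w₀ with
      C := (datumOfRecord₁₁ F N θ h).C, γ := γw, L := (θ.L : ℝ), one_lt_L := by exact_mod_cast θ.hL.2,
      up := fun P => upOfRecord₅C F N (θ.view₁₁B10YZW F N Mstar ops ζ lamW) P },
    ⟨θ, h, Mstar, ops, ζ, lamW, hθ, rfl, rfl, hγw, rfl, fun _ => rfl⟩, rfl⟩

variable {F N}
variable {D : FiniteEpsData F (SU N)} {w : WorldP}

/-- **Refinement `IsRecordOfRecord₁₁CB10YZW → IsRecordOfRecord₁₁C`** with THE SAME datum AND world: witness the quadruply pinned parameters (provisos transported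
field by field with EXPLICIT proofs, datum `rfl` ×4, view `view₁₁B10YZW_eq`). [cite: Balaban1989LargeFieldII, Thm 1 + (0.1) pp.355–356 (bookkeeping)] -/
theorem isRecordOfRecord₁₁C_of_isRecordOfRecord₁₁CB10YZW (h : IsRecordOfRecord₁₁CB10YZW F N D w) : IsRecordOfRecord₁₁C F N D w := by
  obtain ⟨θ, hP, Mstar, ops, ζ, lamW, hθ, hD, hC, hγ, hL, hup⟩ := h
  have h₁ : (θ.pinB10 F N).Provisos₁₁ := hP.pinB10
  have h₂ : ((θ.pinB10 F N).pinY F N (Y9OfRecord N θ.toStage3Params Mstar ops)).Provisos₁₁ := h₁.pinY _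
  have h₃ : (((θ.pinB10 F N).pinY F N (Y9OfRecord N θ.toStage3Params Mstar ops)).pinZ F N (Z11OfRecord F N ζ)).Provisos₁₁ := h₂.pinZ _
  have h₄ : ((((θ.pinB10 F N).pinY F N (Y9OfRecord N θ.toStage3Params Mstar ops)).pinZ F N (Z11OfRecord F N ζ)).pinW F N (WOfRecord₁₁ F N θ lamW)).Provisos₁₁ :=
    h₃.pinW _
  have hθ' : ((((θ.pinB10 F N).pinY F N (Y9OfRecord N θ.toStage3Params Mstar ops)).pinZ F N (Z11OfRecord F N ζ)).pinW F N (WOfRecord₁₁ F N θ lamW)).Admissible :=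
    (Stage11Params.pinW_admissible_iff F N _ _).2 ((Stage11Params.pinZ_admissible_iff F N _ _).2
      ((Stage11Params.pinY_admissible_iff F N _ _).2 ((Stage11Params.pinB10_admissible_iff F N _).2 hθ)))
  refine ⟨_, h₄, hθ', ?_, hC, hγ, hL, fun P => ?_⟩
  · rw [datumOfRecord₁₁_pinW F N _ h₃, datumOfRecord₁₁_pinZ F N _ h₂, datumOfRecord₁₁_pinY F N _ h₁, datumOfRecord₁₁_pinB10 F N θ hP]
    exact hD
  · rw [hup P, Stage11Params.view₁₁B10YZW_eq]

/-- The `atWorld` transfer (def-T's `atWorld_of_isRecordOfRecord₁₁C` by name). [cite: Balaban1989LargeFieldII, Thm 1 p.355 (bookkeeping)] -/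
theorem atWorld_of_isRecordOfRecord₁₁CB10YZW {X : Dag.Leaves → Prop}
    (h₅ : ∀ (D : FiniteEpsData F (SU N)) (w : WorldP), IsRecordOfRecord₅C F N D w → ∀ P : B12.RunParams, X (leavesP w P))
    (h : IsRecordOfRecord₁₁CB10YZW F N D w) (P : B12.RunParams) : X (leavesP w P) :=
  atWorld_of_isRecordOfRecord₁₁C h₅ (isRecordOfRecord₁₁C_of_isRecordOfRecord₁₁CB10YZW h) P

/-- RE-BINDING a `₁₁C` record's world by the four-pin view gives a record of this module with the SAME datum. [cite: Balaban1989LargeFieldII, Thm 1 p.355 (bookkeeping)] -/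
theorem isRecordOfRecord₁₁CB10YZW_rebind_of_isRecordOfRecord₁₁C (h : IsRecordOfRecord₁₁C F N D w) :
    ∃ (θ : Stage11Params F N) (_ : θ.Provisos₁₁), θ.Admissible ∧ (∀ P, w.up P = upOfRecord₅C F N (θ.toStage5₁₁ F N) P) ∧
      ∀ (Mstar : ℕ) (ops : OpsY N θ.toStage3Params Mstar) (ζ : ResidZ F N) (lamW : ResidW F N),
        IsRecordOfRecord₁₁CB10YZW F N D { w with up := fun P => upOfRecord₅C F N (θ.view₁₁B10YZW F N Mstar ops ζ lamW) P } := by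
  obtain ⟨θ, hP, hθ, hD, hC, hγ, hL, hup⟩ := h
  exact ⟨θ, hP, hθ, hup, fun Mstar ops ζ lamW => ⟨θ, hP, Mstar, ops, ζ, lamW, hθ, hD, hC, hγ, hL, fun _ => rfl⟩⟩

/-- **THE FOUR PINNED LEAVES AT A RECORD OF THIS MODULE, for ONE parameter package**. [cite: Balaban1989LargeFieldI, Prop. 1 p.194; Balaban1985Variational, Thm 1 p.279; Balaban1985BackgroundPropagators, Thm 3.1 p.397; Balaban1985UV3, Thm 1 p.257] -/
theorem leaves_iff_of_isRecordOfRecord₁₁CB10YZW (h : IsRecordOfRecord₁₁CB10YZW F N D w) :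
    ∃ (θ : Stage11Params F N) (Mstar : ℕ) (ops : OpsY N θ.toStage3Params Mstar) (ζ : ResidZ F N) (lamW : ResidW F N), θ.Admissible ∧ w.L = (θ.L : ℝ) ∧
      ∀ P : B12.RunParams,
        ((leavesP w P).rBasicStep ↔ B15Leaf (WOfRecord₁₁ F N θ lamW P)) ∧ ((leavesP w P).b9 ↔ B9LeafX (Y9OfRecord N θ.toStage3Params Mstar ops)) ∧
        ((leavesP w P).b10 ↔ PrintedUV3V N θ.L) ∧ ((leavesP w P).b11 ↔ B11Leaf (Z11OfRecord F N ζ)) := by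
  obtain ⟨θ, -, Mstar, ops, ζ, lamW, hθ, -, -, -, hL, hup⟩ := h
  refine ⟨θ, Mstar, ops, ζ, lamW, hθ, hL, fun P => ?_⟩
  have hl := upOfRecord₅C_view₁₁B10YZW_leaves F N θ Mstar ops ζ lamW P
  refine ⟨?_, ?_, ?_, ?_⟩
  · show (w.up P).rBasicStep ↔ _
    rw [hup P]; exact hl.1
  · show (w.up P).b9 ↔ _
    rw [hup P]; exact hl.2.1
  · show (w.up P).b10 ↔ _
    rw [hup P]; exact hl.2.2.1
  · show (w.up P).b11 ↔ _
    rw [hup P]; exact hl.2.2.2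

/-- **N08 at a record of this module, EXACTLY**. [cite: Balaban1985UV3, Thm 1 p.257 + Thm 2 p.272 (the node's shape `Dag.B10_main`, bookkeeping)] -/
theorem b10_main_iff_of_isRecordOfRecord₁₁CB10YZW (h : IsRecordOfRecord₁₁CB10YZW F N D w) :
    ∃ L : ℕ, (Odd L ∧ 1 < L) ∧ w.L = (L : ℝ) ∧ ∀ P : B12.RunParams,
      (Dag.B10_main (leavesP w P) ↔
        ((leavesP w P).b5 → (leavesP w P).b6 → (leavesP w P).b7 → (leavesP w P).b8 → (leavesP w P).b9 → (leavesP w P).b11 →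
          PrintedUV3V N L)) := by
  obtain ⟨θ, Mstar, ops, ζ, lamW, -, hwL, hl⟩ := leaves_iff_of_isRecordOfRecord₁₁CB10YZW h
  refine ⟨θ.L, θ.hL, hwL, fun P => ?_⟩
  unfold Dag.B10_main
  rw [(hl P).2.2.1]

/-- **N07 AT A RECORD OF THIS MODULE, AT THE BUNDLES OF RECORD** (`b4 b5 b6 b7` theorems of the record). [cite: Balaban1985Variational, Thm 1 p.279, Props 2–9 pp.281–309 (bookkeeping: the node at a record)] -/
theorem b11_main_iff_bundles_of_isRecordOfRecord₁₁CB10YZW (h : IsRecordOfRecord₁₁CB10YZW F N D w) :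
    ∃ (θ : Stage11Params F N) (Mstar : ℕ) (ops : OpsY N θ.toStage3Params Mstar) (ζ : ResidZ F N), θ.Admissible ∧ w.L = (θ.L : ℝ) ∧
      ∀ P : B12.RunParams,
        (Dag.B11_main (leavesP w P) ↔
          ((leavesP w P).b8 → B9LeafX (Y9OfRecord N θ.toStage3Params Mstar ops) → B11Leaf (Z11OfRecord F N ζ))) := by
  obtain ⟨θ, Mstar, ops, ζ, lamW, hθ, hL, hl⟩ := leaves_iff_of_isRecordOfRecord₁₁CB10YZW h
  refine ⟨θ, Mstar, ops, ζ, hθ, hL, fun P => ?_⟩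
  have h57 : Dag.B11_main (leavesP w P) ↔ ((leavesP w P).b8 → (leavesP w P).b9 → (leavesP w P).b11) :=
    atWorld_of_isRecordOfRecord₁₁CB10YZW (X := fun ℓ => Dag.B11_main ℓ ↔ (ℓ.b8 → ℓ.b9 → ℓ.b11))
      (fun _ _ h5 P => B11LeafUnpinnedRecord.b11_main_iff_of_isRecordOfRecord₅C h5 P) h P
  rw [h57, (hl P).2.1, (hl P).2.2.2]

/-- **N06 ∕ N07 ∕ N12 «SLOTS» FORM at a record of this module** (hypotheses over the HIDDEN residual layers — honest).
[cite: Balaban1985BackgroundPropagators, Thms 3.1–3.15 pp.397–432; Balaban1985Variational, Thm 1 p.279; Balaban1989LargeFieldI, Prop. 1 p.194, (0.2)–(0.6) p.176 (the nodes' shapes, bookkeeping)] -/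
theorem b9_b11_b15_main_of_isRecordOfRecord₁₁CB10YZW_of_slots (h : IsRecordOfRecord₁₁CB10YZW F N D w)
    (hYZW : ∀ (θ : Stage11Params F N) (hP : θ.Provisos₁₁) (Mstar : ℕ) (ops : OpsY N θ.toStage3Params Mstar) (ζ : ResidZ F N) (lamW : ResidW F N), θ.Admissible →
      D = datumOfRecord₁₁ F N θ hP → (∀ P, w.up P = upOfRecord₅C F N (θ.view₁₁B10YZW F N Mstar ops ζ lamW) P) →
        B9LeafX (Y9OfRecord N θ.toStage3Params Mstar ops) ∧ B11Leaf (Z11OfRecord F N ζ) ∧ ∀ P, B15Leaf (WOfRecord₁₁ F N θ lamW P))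
    (P : B12.RunParams) : Dag.B9_main (leavesP w P) ∧ Dag.B11_main (leavesP w P) ∧ Dag.B15_main (leavesP w P) := by
  obtain ⟨θ, hP, Mstar, ops, ζ, lamW, hθ, hD, -, -, -, hup⟩ := h
  have hl := upOfRecord₅C_view₁₁B10YZW_leaves F N θ Mstar ops ζ lamW P
  have hyzw := hYZW θ hP Mstar ops ζ lamW hθ hD hup
  refine ⟨fun _ _ _ _ => ?_, fun _ _ _ _ _ => ?_, fun _ _ _ _ _ => ?_⟩
  · show (w.up P).b9
    rw [hup P]; exact hl.2.1.2 hyzw.1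
  · show (w.up P).b11
    rw [hup P]; exact hl.2.2.2.2 hyzw.2.1
  · show (w.up P).rBasicStep
    rw [hup P]; exact hl.1.2 (hyzw.2.2 P)

end Record11

end Literature.MathematicalPhysics.QuantumFieldTheory.Balaban1983to89.Node00

end
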